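import Mathlib
import Summits.ResolutionOfSingularities.ResolutionOfSingularities.Theorems.RadicialJungCleanModelsLens5PRankTwoCurrency
import HarnessLib

/-!
# Lens 5 — PRankTwo SEP-FIN currency (THEOREM T′_fin / T′₁): PORT-READY CANDIDATE

Crux workfile `Cruxes/DescentPerfectToAll/Lens5_TPrimeCurrency.lean` (res-B-lens-5 g13).  OURS · CANDIDATE · counted 0; nothing here
proves resolution in characteristic `p`; resolution in char p NOT proved.

This file is the DEFINITIONS-ONLY part (§B/§B′) of `Cruxes/DescentPerfectToAll/Lens5_TPrime.lean` rev 3 (crux commit a15aee1d26d5),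
token-identical, plus three Mathlib-only sanity lemmas (§C′ bridge B1 in the `k`-rational case; T′₁ ⊂ T′_fin; T′_fin ⊇ T up to (SEP-K)),
laid out exactly like the ported currency of THEOREM T (✓ `Theorems/RadicialJungCleanModelsLens5PRankTwoCurrency.lean`) so that a porter can
byte-copy it to `Theorems/RadicialJungCleanModelsLens5PRankTwoSepFinCurrency.lean` — which is what the lead's rev 29 of
`Cruxes/CleanModels/Lines/Sketch.lean` needs in order to STATE the fifth negated side condition of `stub_cleanLU3DefectNonDiscrete`
(critic TRIAGE-135: «currency defs must be importable from a Theorems/ module before rev 29 states it»).  When the theorem file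
`Lens5_TPrime.lean` is ported afterwards, its §B/§B′/§C′ and the two corollaries of §H are DELETED there and this namespace is opened instead.

## Contents
* `SepGenerated k K` — `K/k` separably generated.
* `IsPGenerator p θ`, `ResiduallyPIndependent p O Θ`, `CleanLU3DefectPRankTwoSepRkOneAt p` — T′₁'s currency (`p`-rank one).
* `IsPSpanningFamily p b`, `ResiduallyPIndependentFamily p O B`, `CleanLU3DefectPRankTwoSepFinAt p` — T′_fin's currency (finite `p`-rank).
* `residuallyPIndependentFamily_of_rational` — bridge B1 on `k`-rational valuations: (RPI-fam) ⟸ `k^p`-linear independence of `b`.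
* `cleanLU3DefectPRankTwoSepRkOne_of_sepFin` — T′₁'s slice from T′_fin's (`S := Fin p`, `b i := θ^i`).
* `cleanLU3DefectPRankTwo_sep_of_sepFin` — T′_fin's slice gives T's slice ✓`CleanLU3DefectPRankTwoAt p` plus the binder `SepGenerated k K`
  (`S := Unit`, `b := 1` over a perfect `k`).
-/

noncomputable section

set_option linter.dupNamespace false

open IsLocalRing
open Literature.AlgebraicGeometry.Resolution
open Summit.ResolutionOfSingularities.ResolutionOfSingularities.Theorems.RadicialJung.CleanModels.Lens5.PRankTwoCurrency

namespace Summit.ResolutionOfSingularities.ResolutionOfSingularities.Theorems.RadicialJung.CleanModels.Lens5.PRankTwoSepFinCurrency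

/-! ## §B Currency of T′₁ (`p`-rank one; kept — T′₁ is the corollary `S := Fin p`, `b i := θ^i` of T′_fin, §H) -/

/-- `K/k` separably generated (census `Census_lens5_pRankTwo.lean` def, verbatim). [folklore] -/
def SepGenerated (k K : Type) [Field k] [Field K] [Algebra k K] : Prop :=
    ∃ (n : ℕ) (s : Fin n → K), AlgebraicIndependent k s ∧ Algebra.IsSeparable (IntermediateField.adjoin k (Set.range s)) K

/-- **`θ` is a `p`-generator of `k`**: `k = k^p[θ] = Σ_{i<p} k^p θ^i`, i.e. `[k : k^p] ≤ p` (`p`-rank ≤ 1). [folklore] -/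
def IsPGenerator (p : ℕ) {k : Type} [Field k] (θ : k) : Prop :=
    ∀ c : k, ∃ d : Fin p → k, c = ∑ i : Fin p, d i ^ p * θ ^ (i : ℕ)

/-- **Residual `p`-independence of `1, Θ, …, Θ^{p-1}`** along `v` (in-`K` form): a combination `Σ_{i<p} w_i^p Θ^i` with integral
coefficients one of which is a unit is a unit.  For `Θ ∈ k` and `κ_v/k` algebraic this says that the `p`-basis `{θ}` of `k` stays
`p`-independent in `κ_v`, i.e. `κ_v/k` is separable. [folklore] -/
def ResiduallyPIndependent (p : ℕ) {K : Type} [Field K] (O : ValuationSubring K) (Θ : K) : Prop :=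
    ∀ w : Fin p → K, (∀ i, w i ∈ O) → (∃ i, O.valuation (w i) = 1) →
      O.valuation (∑ i : Fin p, w i ^ p * Θ ^ (i : ℕ)) = 1

/-- **THEOREM T′₁'s slice**: `stub_cleanLU3DefectNonDiscrete` at `p` on {`[Γ : pΓ] = p²`, `K/k` separably generated, `k` of
`p`-rank ≤ 1 with `p`-generator `θ` residually `p`-independent along `v`} — NO `PerfectField k`. [folklore] -/
def CleanLU3DefectPRankTwoSepRkOneAt (p : ℕ) : Prop :=
    ∀ (k : Type) [Field k] [CharP k p] (K : Type) [Field K] [Algebra k K]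
    (O : ValuationSubring K) (A : Subalgebra k K), A.toSubring ≤ O.toSubring → A.FG → IsFractionRing A K →
    ringKrullDim A ≤ 3 → IsRegularLocalRing (locAtCentre A.toSubring O) →
    ringKrullDim (locAtCentre A.toSubring O) = 3 →
    (∀ (T : Subring K) (hT : T ≤ O.toSubring), A.toSubring ≤ T → (subringCentre T O hT).IsMaximal) →
    ∀ g₀ : K, (∀ c : K, c ^ p ≠ g₀) →
    (∀ f₀ : K, ∃ f₁ : K, O.valuation (g₀ - f₁ ^ p) < O.valuation (g₀ - f₀ ^ p)) →
    (∀ hk : ∀ c : k, algebraMap k K c ∈ O, transcendenceDefect k O hk ≠ 0) →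
    ¬ (∃ π : K, π ≠ 0 ∧ (∀ x : K, O.valuation x < 1 → O.valuation x ≤ O.valuation π) ∧
      (∀ x : K, x ≠ 0 → ∃ n : ℕ, O.valuation π ^ n ≤ O.valuation x)) →
    PRankTwoAt p O → SepGenerated k K →
    ∀ θ : k, IsPGenerator p θ → ResiduallyPIndependent p O (algebraMap k K θ) →
    CleanLUConcl p k K O A g₀

/-! ### §B′ Currency of T′_fin (finite `p`-rank): a finite `p`-spanning family of `k`, residually `p`-independent along `v` -/

/-- **A finite `p`-spanning family of `k`**: `k = Σ_{s ∈ S} k^p · b_s` (`S` finite).  Any field of FINITE `p`-rank `e` has one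
(the `p^e` monomials in a `p`-basis); `p`-rank one = the family `1, θ, …, θ^{p-1}`. [folklore] -/
def IsPSpanningFamily (p : ℕ) {k : Type} [Field k] {S : Type} [Fintype S] (b : S → k) : Prop :=
    ∀ c : k, ∃ d : S → k, c = ∑ s : S, d s ^ p * b s

/-- **Residual `p`-independence of a finite family** `B : S → K` along `v` (in-`K` form): `Σ_s w_s^p B_s` is a `v`-unit whenever the
`w_s ∈ O` are not all in `𝔪_v`.  For `B = b` a `p`-spanning family of `k ⊆ O` and `κ_v/k` algebraic this says that the `p`-basis of `k`
extracted from `b` stays `p`-independent in `κ_v`, i.e. (MacLane) `κ_v/k` is SEPARABLE. [folklore] -/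
def ResiduallyPIndependentFamily (p : ℕ) {K : Type} [Field K] (O : ValuationSubring K) {S : Type} [Fintype S]
    (B : S → K) : Prop :=
    ∀ w : S → K, (∀ s, w s ∈ O) → (∃ s, O.valuation (w s) = 1) → O.valuation (∑ s : S, w s ^ p * B s) = 1

/-- **THEOREM T′_fin's slice**: `stub_cleanLU3DefectNonDiscrete` at `p` on {`[Γ : pΓ] = p²`, `K/k` separably generated, `k` with a
FINITE `p`-spanning family (finite `p`-rank) residually `p`-independent along `v`} — NO `PerfectField k`. [folklore] -/
def CleanLU3DefectPRankTwoSepFinAt (p : ℕ) : Prop :=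
    ∀ (k : Type) [Field k] [CharP k p] (K : Type) [Field K] [Algebra k K]
    (O : ValuationSubring K) (A : Subalgebra k K), A.toSubring ≤ O.toSubring → A.FG → IsFractionRing A K →
    ringKrullDim A ≤ 3 → IsRegularLocalRing (locAtCentre A.toSubring O) →
    ringKrullDim (locAtCentre A.toSubring O) = 3 →
    (∀ (T : Subring K) (hT : T ≤ O.toSubring), A.toSubring ≤ T → (subringCentre T O hT).IsMaximal) →
    ∀ g₀ : K, (∀ c : K, c ^ p ≠ g₀) →
    (∀ f₀ : K, ∃ f₁ : K, O.valuation (g₀ - f₁ ^ p) < O.valuation (g₀ - f₀ ^ p)) →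
    (∀ hk : ∀ c : k, algebraMap k K c ∈ O, transcendenceDefect k O hk ≠ 0) →
    ¬ (∃ π : K, π ≠ 0 ∧ (∀ x : K, O.valuation x < 1 → O.valuation x ≤ O.valuation π) ∧
      (∀ x : K, x ≠ 0 → ∃ n : ℕ, O.valuation π ^ n ≤ O.valuation x)) →
    PRankTwoAt p O → SepGenerated k K →
    ∀ (S : Type) [Fintype S] (b : S → k), IsPSpanningFamily p b →
    ResiduallyPIndependentFamily p O (fun s => algebraMap k K (b s)) →
    CleanLUConcl p k K O A g₀


/-! ### §C′ Bridge B1 in the `k`-RATIONAL case: for a valuation with residue field `k` (every element of `O` is congruent to a constant),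
residual `p`-independence of `b` read in `K` is just `k^p`-linear independence of `b` in `k` (so (FIN)+(RPI-fam) = «`b` is a `p`-basis-monomial
basis of `k` over `k^p`»).  The general bridge («`κ_v/k` separable algebraic», Mac Lane) is by hand in the memo (§17/§18), not formalised. -/

/-- Constants are `v`-units. [folklore] -/
theorem valuation_algebraMap_eq_one {k K : Type} [Field k] [Field K] [Algebra k K] (O : ValuationSubring K)
    (hk : ∀ c : k, algebraMap k K c ∈ O) {c : k} (hc : c ≠ 0) : O.valuation (algebraMap k K c) = 1 := by
  have h1 : O.valuation (algebraMap k K c) ≤ 1 := (O.valuation_le_one_iff _).mpr (hk c)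
  have h2 : O.valuation (algebraMap k K c⁻¹) ≤ 1 := (O.valuation_le_one_iff _).mpr (hk c⁻¹)
  have hprod : O.valuation (algebraMap k K c) * O.valuation (algebraMap k K c⁻¹) = 1 := by
    rw [← map_mul, ← map_mul, mul_inv_cancel₀ hc, map_one, map_one]
  refine le_antisymm h1 ?_
  calc (1 : _) = O.valuation (algebraMap k K c) * O.valuation (algebraMap k K c⁻¹) := hprod.symm
    _ ≤ O.valuation (algebraMap k K c) * 1 := by gcongr
    _ = O.valuation (algebraMap k K c) := mul_one _

/-- **Bridge B1, `k`-rational case.**  If the residue field of `v` is `k` (`hrat`: every `x ∈ O` is `≡` a constant mod `𝔪_v`) and the finite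
family `b` is `k^p`-linearly independent in `k` (`hbli`, in-`k` elementary form), then `b` is residually `p`-independent along `v`. [folklore] -/
theorem residuallyPIndependentFamily_of_rational (p : ℕ) [Fact p.Prime] {k K : Type} [Field k] [CharP k p] [Field K] [Algebra k K]
    (O : ValuationSubring K) (hk : ∀ c : k, algebraMap k K c ∈ O)
    (hrat : ∀ x : K, x ∈ O → ∃ c : k, O.valuation (x - algebraMap k K c) < 1)
    {S : Type} [Fintype S] (b : S → k) (hbli : ∀ d : S → k, ∑ s, d s ^ p * b s = 0 → ∀ s, d s = 0) :
    ResiduallyPIndependentFamily p O (fun s => algebraMap k K (b s)) := by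
  classical
  have hp : p.Prime := Fact.out
  haveI : CharP K p := charP_of_injective_algebraMap (algebraMap k K).injective p
  intro w hw hw1
  obtain ⟨s₀, hs₀⟩ := hw1
  choose c hc using fun s => hrat (w s) (hw s)
  -- the unit coefficient has a non-zero constant
  have hc₀ : c s₀ ≠ 0 := by
    intro h0
    have := hc s₀
    rw [h0, map_zero, sub_zero, hs₀] at this
    exact lt_irrefl _ this
  -- hence the constant combination is a non-zero constant, a `v`-unit
  have hsum0 : ∑ s, c s ^ p * b s ≠ 0 := fun h0 => hc₀ (hbli c h0 s₀)
  have hunit : O.valuation (algebraMap k K (∑ s, c s ^ p * b s)) = 1 := valuation_algebraMap_eq_one O hk hsum0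
  -- the difference lies in `𝔪_v`
  set D : K := ∑ s, (w s ^ p - algebraMap k K (c s) ^ p) * algebraMap k K (b s) with hD
  have hDlt : O.valuation D < 1 := by
    refine Valuation.map_sum_lt _ one_ne_zero fun s _ => ?_
    rw [← sub_pow_char, map_mul, map_pow]
    have hb1 : O.valuation (algebraMap k K (b s)) ≤ 1 := (O.valuation_le_one_iff _).mpr (hk _)
    calc O.valuation (w s - algebraMap k K (c s)) ^ p * O.valuation (algebraMap k K (b s))
        ≤ O.valuation (w s - algebraMap k K (c s)) ^ p * 1 := by gcongr
      _ = O.valuation (w s - algebraMap k K (c s)) ^ p := mul_one _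
      _ < 1 := pow_lt_one₀ zero_le (hc s) hp.ne_zero
  have hsplit : ∑ s, w s ^ p * algebraMap k K (b s) = algebraMap k K (∑ s, c s ^ p * b s) + D := by
    rw [hD, map_sum, ← Finset.sum_add_distrib]
    refine Finset.sum_congr rfl fun s _ => ?_
    rw [map_mul, map_pow]; ring
  rw [hsplit, Valuation.map_add_eq_of_lt_left _ (by rw [hunit]; exact hDlt), hunit]

/-! ## §2 The two specialisations of T′_fin's slice -/

/-- **T′₁ ⊂ T′_fin**: the `p`-rank-one slice is the case `S := Fin p`, `b i := θ^i` of the finite-`p`-rank slice. [folklore] -/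
theorem cleanLU3DefectPRankTwoSepRkOne_of_sepFin (p : ℕ) [Fact p.Prime]
    (hFin : CleanLU3DefectPRankTwoSepFinAt p) : CleanLU3DefectPRankTwoSepRkOneAt p := by
  intro k _ _ K _ _ O A hAO hAfg hFrac hdimA hreg hdim3 hzd g₀ hg₀ hdefect htd hnd hP2 hsep θ hθ hPI
  refine hFin k K O A hAO hAfg hFrac hdimA hreg hdim3 hzd g₀ hg₀ hdefect htd hnd hP2 hsep (Fin p)
    (fun i => θ ^ (i : ℕ)) (fun c => hθ c) ?_
  intro w hw hw1
  simpa only [map_pow] using hPI w hw hw1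

/-- **T′_fin ⊇ T up to (SEP-K)** (statement-level sanity of the new slice — the degenerate instance of §B′; not used elsewhere): over a PERFECT
field the one-element family `b = 1` is `p`-spanning (`c = (c^{1/p})^p`) and trivially residually `p`-independent, so
`CleanLU3DefectPRankTwoSepFinAt p` yields the conclusion of T's slice ✓ `CleanLU3DefectPRankTwoAt p` under the single extra binder
`SepGenerated k K` (automatic for `K` finitely generated over a perfect field, Hartshorne I.4.8A — not formalised here). [folklore] -/
theorem cleanLU3DefectPRankTwo_sep_of_sepFin (p : ℕ) [Fact p.Prime] (hFin : CleanLU3DefectPRankTwoSepFinAt p) :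
    ∀ (k : Type) [Field k] [CharP k p] [PerfectField k] (K : Type) [Field K] [Algebra k K]
    (O : ValuationSubring K) (A : Subalgebra k K), A.toSubring ≤ O.toSubring → A.FG → IsFractionRing A K →
    ringKrullDim A ≤ 3 → IsRegularLocalRing (locAtCentre A.toSubring O) →
    ringKrullDim (locAtCentre A.toSubring O) = 3 →
    (∀ (T : Subring K) (hT : T ≤ O.toSubring), A.toSubring ≤ T → (subringCentre T O hT).IsMaximal) →
    ∀ g₀ : K, (∀ c : K, c ^ p ≠ g₀) →
    (∀ f₀ : K, ∃ f₁ : K, O.valuation (g₀ - f₁ ^ p) < O.valuation (g₀ - f₀ ^ p)) →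
    (∀ hk : ∀ c : k, algebraMap k K c ∈ O, transcendenceDefect k O hk ≠ 0) →
    ¬ (∃ π : K, π ≠ 0 ∧ (∀ x : K, O.valuation x < 1 → O.valuation x ≤ O.valuation π) ∧
      (∀ x : K, x ≠ 0 → ∃ n : ℕ, O.valuation π ^ n ≤ O.valuation x)) →
    PRankTwoAt p O → SepGenerated k K →
    CleanLUConcl p k K O A g₀ := by
  intro k _ _ _ K _ _ O A hAO hAfg hFrac hdimA hreg hdim3 hzd g₀ hg₀ hdefect htd hnd hP2 hsep
  have hp : p.Prime := Fact.out
  haveI : ExpChar k p := ExpChar.prime hp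
  haveI : PerfectRing k p := PerfectField.toPerfectRing p
  refine hFin k K O A hAO hAfg hFrac hdimA hreg hdim3 hzd g₀ hg₀ hdefect htd hnd hP2 hsep Unit (fun _ => (1 : k)) ?_ ?_
  · intro c
    obtain ⟨d, hd⟩ := surjective_frobenius k p c
    refine ⟨fun _ => d, ?_⟩
    rw [Fintype.sum_unique, mul_one, ← hd, frobenius_def]
  · rintro w - ⟨s, hs⟩
    rw [Fintype.sum_unique, map_one, mul_one, map_pow, Subsingleton.elim (default : Unit) s, hs, one_pow]


end Summit.ResolutionOfSingularities.ResolutionOfSingularities.Theorems.RadicialJung.CleanModels.Lens5.PRankTwoSepFinCurrency
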